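import Summits.CriticalPhenomena.PercolationContinuityZ3.Theorems.PercNearOneGluingNoHeavyLowerTailForestRayleighTwoSeparation
import HarnessLib

/-!
# Weighted forest negative correlation — 2-separations II: the two-state decomposition of the partition function

Notation as in `…ForestRayleighTools` / `…ForestRayleighTwoSeparation`: `Z(D;K) = Σ_{G ⊆ D, ⟨G ∪ K⟩ acyclic} ∏ w`,
two sides with edges on `S₁`, `S₂`, `S₁ ∩ S₂ ⊆ {s,t}`, marker `m = st` on neither side.

* `sum_pinned_union` (abstract): `Z_Q(D₁ ∪ D₂;K) = Σ_{G₁ ⊆ D₁} w^{G₁} · Z_Q(D₂; G₁ ∪ K)` for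
  disjoint free sets;
* `forestsW_sep_pin`: `Z(D₁ ∪ D₂; K₁ ∪ K₂ ∪ m) = Z(D₁;K₁ ∪ m) · Z(D₂;K₂ ∪ m)`;
* `forestsW_sep`: `Z(D₁ ∪ D₂; K₁ ∪ K₂) = Z(D₁;K₁∪m)·Z(D₂;K₂) + Z(D₁;K₁)·Z(D₂;K₂∪m) − Z(D₁;K₁∪m)·Z(D₂;K₂∪m)`
  — a spanning forest of the 2-sum is a pair of forests of the sides not joining `s, t` on both
  sides (`Z(Dᵢ;Kᵢ ∪ m)` counts the side-forests with `s ≁ t`).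

[folklore two-terminal decomposition; used for Semple–Welsh 2008 §5 Q.2 in `…ForestRayleighTwoSum`]
Theorems only; no definitions, no `sorry`.
-/

open Finset SimpleGraph
open scoped Classical

namespace Summit.CriticalPhenomena.PercolationContinuityZ3.Theorems.ForestRayleigh

/-! ### §1 Fubini for pinned partition functions -/

section Abstract

variable {α : Type*} [DecidableEq α]

/-- **Fubini for pinned partition functions.** For disjoint free sets `D₁, D₂`:
`Z_Q(D₁ ∪ D₂;K) = Σ_{G₁ ⊆ D₁} (∏_{G₁} w) · Z_Q(D₂;G₁ ∪ K)`. [elementary] -/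
theorem sum_pinned_union (w : α → ℝ) (Q : Finset α → Prop) [DecidablePred Q]
    (D₁ D₂ K : Finset α) (hD : Disjoint D₁ D₂) :
    ∑ G ∈ (D₁ ∪ D₂).powerset.filter (fun G => Q (G ∪ K)), ∏ g ∈ G, w g =
      ∑ G₁ ∈ D₁.powerset, (∏ g ∈ G₁, w g) *
        ∑ G₂ ∈ D₂.powerset.filter (fun G₂ => Q (G₂ ∪ (G₁ ∪ K))), ∏ g ∈ G₂, w g := by
  induction D₁ using Finset.induction_on generalizing K with
  | empty =>
    rw [Finset.powerset_empty, Finset.sum_singleton, Finset.prod_empty, one_mul, Finset.empty_union]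
    simp only [Finset.empty_union]
  | insert g D₁ hg ih =>
    have hg₂ : g ∉ D₂ := fun h => (Finset.disjoint_insert_left.1 hD).1 h
    have hD' : Disjoint D₁ D₂ := (Finset.disjoint_insert_left.1 hD).2
    have hgU : g ∉ D₁ ∪ D₂ := by rw [Finset.mem_union, not_or]; exact ⟨hg, hg₂⟩
    have hins : insert g D₁ ∪ D₂ = insert g (D₁ ∪ D₂) := Finset.insert_union g D₁ D₂
    rw [hins, ConnMonotone.sum_pinned_split w Q (insert g (D₁ ∪ D₂)) K (Finset.mem_insert_self _ _),
      Finset.erase_insert hgU, ih K hD', ih (insert g K) hD', Finset.sum_powerset_insert hg,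
      Finset.mul_sum]
    congr 1
    apply Finset.sum_congr rfl
    intro G₁ hG₁
    have hgG : g ∉ G₁ := fun h => hg (Finset.mem_powerset.1 hG₁ h)
    rw [Finset.prod_insert hgG, Finset.insert_union, Finset.union_insert]
    ring

omit [DecidableEq α] in
/-- A sum over the power set weighted by an indicator is the pinned partition function.
[elementary] -/
theorem sum_powerset_ite_eq (w : α → ℝ) (P : Finset α → Prop) [DecidablePred P] (D : Finset α)
    (c : ℝ) :
    ∑ G ∈ D.powerset, (∏ g ∈ G, w g) * (if P G then c else 0) =
      c * ∑ G ∈ D.powerset.filter (fun G => P G), ∏ g ∈ G, w g := by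
  rw [Finset.sum_filter, Finset.mul_sum]
  apply Finset.sum_congr rfl
  intro G _
  split_ifs <;> ring

end Abstract

/-! ### §2 The two-state decomposition for spanning forests -/

section Forests

variable {V : Type*} [Fintype V] [DecidableEq V]

/-- **Marker pinned: the partition function of a 2-sum factorises.** With free/pinned sets
`D₁, K₁` on `S₁` and `D₂, K₂` on `S₂`, `S₁ ∩ S₂ ⊆ {s,t}`, loop-free, the marker `m = st`
on neither side and `D₁ ∩ D₂ = ∅`:
`Z(D₁ ∪ D₂; (K₁ ∪ K₂) ∪ m) = Z(D₁;K₁ ∪ m) · Z(D₂;K₂ ∪ m)`. [folklore] -/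
theorem forestsW_sep_pin (w : Sym2 V → ℝ) {D₁ K₁ D₂ K₂ : Finset (Sym2 V)} {S₁ S₂ : Set V}
    {s t : V} (h₁ : ∀ z ∈ D₁ ∪ K₁, ∀ x ∈ z, x ∈ S₁) (h₂ : ∀ z ∈ D₂ ∪ K₂, ∀ x ∈ z, x ∈ S₂)
    (hS : ∀ x, x ∈ S₁ → x ∈ S₂ → x = s ∨ x = t) (hst : s ≠ t)
    (hL₁ : ∀ z ∈ D₁ ∪ K₁, ¬z.IsDiag) (hL₂ : ∀ z ∈ D₂ ∪ K₂, ¬z.IsDiag)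
    (hm₁ : s(s, t) ∉ D₁ ∪ K₁) (hm₂ : s(s, t) ∉ D₂ ∪ K₂) (hD : Disjoint D₁ D₂) :
    ∑ G ∈ (D₁ ∪ D₂).powerset.filter (fun G =>
        (fromEdgeSet ((G ∪ insert s(s, t) (K₁ ∪ K₂) : Finset (Sym2 V)) : Set (Sym2 V))).IsAcyclic),
        ∏ x ∈ G, w x =
      (∑ G ∈ D₁.powerset.filter (fun G =>
        (fromEdgeSet ((G ∪ insert s(s, t) K₁ : Finset (Sym2 V)) : Set (Sym2 V))).IsAcyclic),
        ∏ x ∈ G, w x) *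
      (∑ G ∈ D₂.powerset.filter (fun G =>
        (fromEdgeSet ((G ∪ insert s(s, t) K₂ : Finset (Sym2 V)) : Set (Sym2 V))).IsAcyclic),
        ∏ x ∈ G, w x) := by
  rw [sum_pinned_union w
    (fun X : Finset (Sym2 V) => (fromEdgeSet ((X : Finset (Sym2 V)) : Set (Sym2 V))).IsAcyclic)
    D₁ D₂ _ hD]
  -- pointwise in `G₁`: the inner sum is `[⟨G₁ ∪ K₁ ∪ m⟩ acyclic] · Z(D₂;K₂ ∪ m)`
  have inner : ∀ G₁ ∈ D₁.powerset,
      ∑ G₂ ∈ D₂.powerset.filter (fun G₂ =>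
        (fromEdgeSet ((G₂ ∪ (G₁ ∪ insert s(s, t) (K₁ ∪ K₂)) : Finset (Sym2 V)) :
          Set (Sym2 V))).IsAcyclic), ∏ x ∈ G₂, w x =
      (if (fromEdgeSet ((G₁ ∪ insert s(s, t) K₁ : Finset (Sym2 V)) : Set (Sym2 V))).IsAcyclic
        then (1 : ℝ) else 0) *
      ∑ G ∈ D₂.powerset.filter (fun G =>
        (fromEdgeSet ((G ∪ insert s(s, t) K₂ : Finset (Sym2 V)) : Set (Sym2 V))).IsAcyclic),
        ∏ x ∈ G, w x := by
    intro G₁ hG₁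
    have hG₁D : G₁ ⊆ D₁ := Finset.mem_powerset.1 hG₁
    -- enlarge `S₁` by the two terminals (the intersection with `S₂` stays inside `{s,t}`)
    have hX₁ : ∀ z ∈ G₁ ∪ K₁, ∀ x ∈ z, x ∈ (S₁ ∪ {s, t} : Set V) := fun z hz x hx =>
      Or.inl (h₁ z (Finset.union_subset_union hG₁D (subset_refl K₁) hz) x hx)
    have hS' : ∀ x, x ∈ (S₁ ∪ {s, t} : Set V) → x ∈ S₂ → x = s ∨ x = t := by
      intro x hx hx₂
      rcases hx with hx | hx
      · exact hS x hx hx₂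
      · simp only [Set.mem_insert_iff, Set.mem_singleton_iff] at hx
        exact hx
    have hs₁ : s ∈ (S₁ ∪ {s, t} : Set V) := Or.inr (by simp)
    have ht₁ : t ∈ (S₁ ∪ {s, t} : Set V) := Or.inr (by simp)
    have hLX₁ : ∀ z ∈ G₁ ∪ K₁, ¬z.IsDiag := fun z hz =>
      hL₁ z (Finset.union_subset_union hG₁D (subset_refl K₁) hz)
    have hmX₁ : s(s, t) ∉ G₁ ∪ K₁ := fun hz =>
      hm₁ (Finset.union_subset_union hG₁D (subset_refl K₁) hz)
    split_ifs with hac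
    · rw [one_mul]
      apply Finset.sum_congr _ (fun _ _ => rfl)
      ext G₂
      simp only [Finset.mem_filter, Finset.mem_powerset, and_congr_right_iff]
      intro hG₂D
      have hX₂ : ∀ z ∈ G₂ ∪ K₂, ∀ x ∈ z, x ∈ S₂ := fun z hz =>
        h₂ z (Finset.union_subset_union hG₂D (subset_refl K₂) hz)
      have hLX₂ : ∀ z ∈ G₂ ∪ K₂, ¬z.IsDiag := fun z hz =>
        hL₂ z (Finset.union_subset_union hG₂D (subset_refl K₂) hz)
      have hmX₂ : s(s, t) ∉ G₂ ∪ K₂ := fun hz =>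
        hm₂ (Finset.union_subset_union hG₂D (subset_refl K₂) hz)
      have hset : G₂ ∪ (G₁ ∪ insert s(s, t) (K₁ ∪ K₂)) =
          insert s(s, t) (G₁ ∪ K₁) ∪ (G₂ ∪ K₂) := by
        ext z
        simp only [Finset.mem_union, Finset.mem_insert]
        tauto
      have hset₁ : G₁ ∪ insert s(s, t) K₁ = insert s(s, t) (G₁ ∪ K₁) := Finset.union_insert _ _ _
      have hset₂ : G₂ ∪ insert s(s, t) K₂ = insert s(s, t) (G₂ ∪ K₂) := Finset.union_insert _ _ _
      rw [hset, hset₂, isAcyclic_union_sep_pin_iff hX₁ hX₂ hS' hst hs₁ ht₁ hLX₁ hLX₂ hmX₁ hmX₂]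
      rw [hset₁] at hac
      exact ⟨fun h => h.2, fun h => ⟨hac, h⟩⟩
    · rw [zero_mul]
      apply Finset.sum_eq_zero
      intro G₂ hG₂
      simp only [Finset.mem_filter, Finset.mem_powerset] at hG₂
      exfalso
      apply hac
      rw [Finset.union_insert]
      apply isAcyclic_of_subset _ hG₂.2
      intro z hz
      simp only [Finset.mem_union, Finset.mem_insert] at hz ⊢
      tauto
  rw [Finset.sum_congr rfl (fun G₁ hG₁ => by rw [inner G₁ hG₁, ← mul_assoc]), ← Finset.sum_mul,
    sum_powerset_ite_eq, one_mul]

/-- **The two-state decomposition of the spanning-forest partition function of a 2-sum.** With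
free/pinned sets `D₁, K₁` on `S₁` and `D₂, K₂` on `S₂`, `S₁ ∩ S₂ ⊆ {s,t}`, loop-free, the marker
`m = st` on neither side and `D₁ ∩ D₂ = ∅`:
`Z(D₁ ∪ D₂; K₁ ∪ K₂) = Z(D₁;K₁∪m)·Z(D₂;K₂) + Z(D₁;K₁)·Z(D₂;K₂∪m) − Z(D₁;K₁∪m)·Z(D₂;K₂∪m)`:
a pair of side forests is a forest of the union unless `s ~ t` on both sides, and `Z(Dᵢ;Kᵢ∪m)` is
the part of `Z(Dᵢ;Kᵢ)` with `s ≁ t`. [folklore two-terminal (series/2-sum) decomposition] -/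
theorem forestsW_sep (w : Sym2 V → ℝ) {D₁ K₁ D₂ K₂ : Finset (Sym2 V)} {S₁ S₂ : Set V}
    {s t : V} (h₁ : ∀ z ∈ D₁ ∪ K₁, ∀ x ∈ z, x ∈ S₁) (h₂ : ∀ z ∈ D₂ ∪ K₂, ∀ x ∈ z, x ∈ S₂)
    (hS : ∀ x, x ∈ S₁ → x ∈ S₂ → x = s ∨ x = t) (hst : s ≠ t)
    (hL₁ : ∀ z ∈ D₁ ∪ K₁, ¬z.IsDiag) (hL₂ : ∀ z ∈ D₂ ∪ K₂, ¬z.IsDiag)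
    (hm₁ : s(s, t) ∉ D₁ ∪ K₁) (hm₂ : s(s, t) ∉ D₂ ∪ K₂) (hD : Disjoint D₁ D₂) :
    ∑ G ∈ (D₁ ∪ D₂).powerset.filter (fun G =>
        (fromEdgeSet ((G ∪ (K₁ ∪ K₂) : Finset (Sym2 V)) : Set (Sym2 V))).IsAcyclic),
        ∏ x ∈ G, w x =
      (∑ G ∈ D₁.powerset.filter (fun G =>
        (fromEdgeSet ((G ∪ insert s(s, t) K₁ : Finset (Sym2 V)) : Set (Sym2 V))).IsAcyclic),
        ∏ x ∈ G, w x) *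
      (∑ G ∈ D₂.powerset.filter (fun G =>
        (fromEdgeSet ((G ∪ K₂ : Finset (Sym2 V)) : Set (Sym2 V))).IsAcyclic), ∏ x ∈ G, w x) +
      (∑ G ∈ D₁.powerset.filter (fun G =>
        (fromEdgeSet ((G ∪ K₁ : Finset (Sym2 V)) : Set (Sym2 V))).IsAcyclic), ∏ x ∈ G, w x) *
      (∑ G ∈ D₂.powerset.filter (fun G =>
        (fromEdgeSet ((G ∪ insert s(s, t) K₂ : Finset (Sym2 V)) : Set (Sym2 V))).IsAcyclic),
        ∏ x ∈ G, w x) -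
      (∑ G ∈ D₁.powerset.filter (fun G =>
        (fromEdgeSet ((G ∪ insert s(s, t) K₁ : Finset (Sym2 V)) : Set (Sym2 V))).IsAcyclic),
        ∏ x ∈ G, w x) *
      (∑ G ∈ D₂.powerset.filter (fun G =>
        (fromEdgeSet ((G ∪ insert s(s, t) K₂ : Finset (Sym2 V)) : Set (Sym2 V))).IsAcyclic),
        ∏ x ∈ G, w x) := by
  rw [sum_pinned_union w
    (fun X : Finset (Sym2 V) => (fromEdgeSet ((X : Finset (Sym2 V)) : Set (Sym2 V))).IsAcyclic)
    D₁ D₂ _ hD]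
  -- pointwise in `G₁`
  have inner : ∀ G₁ ∈ D₁.powerset,
      ∑ G₂ ∈ D₂.powerset.filter (fun G₂ =>
        (fromEdgeSet ((G₂ ∪ (G₁ ∪ (K₁ ∪ K₂)) : Finset (Sym2 V)) : Set (Sym2 V))).IsAcyclic),
        ∏ x ∈ G₂, w x =
      (if (fromEdgeSet ((G₁ ∪ insert s(s, t) K₁ : Finset (Sym2 V)) : Set (Sym2 V))).IsAcyclic
        then (1 : ℝ) else 0) *
      (∑ G ∈ D₂.powerset.filter (fun G =>
        (fromEdgeSet ((G ∪ K₂ : Finset (Sym2 V)) : Set (Sym2 V))).IsAcyclic), ∏ x ∈ G, w x) +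
      ((if (fromEdgeSet ((G₁ ∪ K₁ : Finset (Sym2 V)) : Set (Sym2 V))).IsAcyclic
        then (1 : ℝ) else 0) -
       (if (fromEdgeSet ((G₁ ∪ insert s(s, t) K₁ : Finset (Sym2 V)) : Set (Sym2 V))).IsAcyclic
        then (1 : ℝ) else 0)) *
      (∑ G ∈ D₂.powerset.filter (fun G =>
        (fromEdgeSet ((G ∪ insert s(s, t) K₂ : Finset (Sym2 V)) : Set (Sym2 V))).IsAcyclic),
        ∏ x ∈ G, w x) := by
    intro G₁ hG₁
    have hG₁D : G₁ ⊆ D₁ := Finset.mem_powerset.1 hG₁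
    have hX₁ : ∀ z ∈ G₁ ∪ K₁, ∀ x ∈ z, x ∈ S₁ := fun z hz =>
      h₁ z (Finset.union_subset_union hG₁D (subset_refl K₁) hz)
    have hLX₁ : ∀ z ∈ G₁ ∪ K₁, ¬z.IsDiag := fun z hz =>
      hL₁ z (Finset.union_subset_union hG₁D (subset_refl K₁) hz)
    have hmX₁ : s(s, t) ∉ G₁ ∪ K₁ := fun hz =>
      hm₁ (Finset.union_subset_union hG₁D (subset_refl K₁) hz)
    have hset₁ : G₁ ∪ insert s(s, t) K₁ = insert s(s, t) (G₁ ∪ K₁) := Finset.union_insert _ _ _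
    -- the filter predicate, rewritten through the separation lemma
    have hpred : ∀ G₂, G₂ ⊆ D₂ →
        ((fromEdgeSet ((G₂ ∪ (G₁ ∪ (K₁ ∪ K₂)) : Finset (Sym2 V)) : Set (Sym2 V))).IsAcyclic ↔
          (fromEdgeSet ((G₁ ∪ K₁ : Finset (Sym2 V)) : Set (Sym2 V))).IsAcyclic ∧
          (fromEdgeSet ((G₂ ∪ K₂ : Finset (Sym2 V)) : Set (Sym2 V))).IsAcyclic ∧
          ¬((fromEdgeSet ((G₁ ∪ K₁ : Finset (Sym2 V)) : Set (Sym2 V))).Reachable s t ∧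
            (fromEdgeSet ((G₂ ∪ K₂ : Finset (Sym2 V)) : Set (Sym2 V))).Reachable s t)) := by
      intro G₂ hG₂D
      have hX₂ : ∀ z ∈ G₂ ∪ K₂, ∀ x ∈ z, x ∈ S₂ := fun z hz =>
        h₂ z (Finset.union_subset_union hG₂D (subset_refl K₂) hz)
      have hLX₂ : ∀ z ∈ G₂ ∪ K₂, ¬z.IsDiag := fun z hz =>
        hL₂ z (Finset.union_subset_union hG₂D (subset_refl K₂) hz)
      have hmX₂ : s(s, t) ∉ G₂ ∪ K₂ := fun hz =>
        hm₂ (Finset.union_subset_union hG₂D (subset_refl K₂) hz)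
      have hset : G₂ ∪ (G₁ ∪ (K₁ ∪ K₂)) = (G₁ ∪ K₁) ∪ (G₂ ∪ K₂) := by
        ext z
        simp only [Finset.mem_union]
        tauto
      rw [hset]
      exact isAcyclic_union_sep_iff hX₁ hX₂ hS hst hLX₁ hLX₂ hmX₂
    -- the `s ≁ t` form of the side-2 predicate
    have hpin₂ : ∀ G₂, G₂ ⊆ D₂ →
        ((fromEdgeSet ((G₂ ∪ insert s(s, t) K₂ : Finset (Sym2 V)) : Set (Sym2 V))).IsAcyclic ↔
          (fromEdgeSet ((G₂ ∪ K₂ : Finset (Sym2 V)) : Set (Sym2 V))).IsAcyclic ∧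
          ¬(fromEdgeSet ((G₂ ∪ K₂ : Finset (Sym2 V)) : Set (Sym2 V))).Reachable s t) := by
      intro G₂ hG₂D
      have hLX₂ : ∀ z ∈ G₂ ∪ K₂, ¬z.IsDiag := fun z hz =>
        hL₂ z (Finset.union_subset_union hG₂D (subset_refl K₂) hz)
      have hmX₂ : s(s, t) ∉ G₂ ∪ K₂ := fun hz =>
        hm₂ (Finset.union_subset_union hG₂D (subset_refl K₂) hz)
      rw [Finset.union_insert]
      exact ForestExchange.isAcyclic_insert_iff hLX₂ hst hmX₂
    by_cases hA : (fromEdgeSet ((G₁ ∪ K₁ : Finset (Sym2 V)) : Set (Sym2 V))).IsAcyclic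
    · by_cases hR : (fromEdgeSet ((G₁ ∪ K₁ : Finset (Sym2 V)) : Set (Sym2 V))).Reachable s t
      · -- side 1 joins `s,t`: side 2 must not
        have hAm : ¬(fromEdgeSet ((G₁ ∪ insert s(s, t) K₁ : Finset (Sym2 V)) :
            Set (Sym2 V))).IsAcyclic := by
          rw [hset₁, ForestExchange.isAcyclic_insert_iff hLX₁ hst hmX₁]
          exact fun h => h.2 hR
        rw [if_neg hAm, if_pos hA, zero_mul, zero_add, sub_zero, one_mul]
        apply Finset.sum_congr _ (fun _ _ => rfl)
        ext G₂
        simp only [Finset.mem_filter, Finset.mem_powerset, and_congr_right_iff]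
        intro hG₂D
        rw [hpred G₂ hG₂D, hpin₂ G₂ hG₂D]
        constructor
        · rintro ⟨_, hB, hC⟩
          exact ⟨hB, fun h => hC ⟨hR, h⟩⟩
        · rintro ⟨hB, hC⟩
          exact ⟨hA, hB, fun h => hC h.2⟩
      · -- side 1 does not join `s,t`: side 2 is free
        have hAm : (fromEdgeSet ((G₁ ∪ insert s(s, t) K₁ : Finset (Sym2 V)) :
            Set (Sym2 V))).IsAcyclic := by
          rw [hset₁, ForestExchange.isAcyclic_insert_iff hLX₁ hst hmX₁]
          exact ⟨hA, hR⟩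
        rw [if_pos hAm, if_pos hA, sub_self, zero_mul, add_zero, one_mul]
        apply Finset.sum_congr _ (fun _ _ => rfl)
        ext G₂
        simp only [Finset.mem_filter, Finset.mem_powerset, and_congr_right_iff]
        intro hG₂D
        rw [hpred G₂ hG₂D]
        constructor
        · rintro ⟨_, hB, _⟩
          exact hB
        · intro hB
          exact ⟨hA, hB, fun h => hR h.1⟩
    · -- side 1 already contains a cycle
      have hAm : ¬(fromEdgeSet ((G₁ ∪ insert s(s, t) K₁ : Finset (Sym2 V)) :
          Set (Sym2 V))).IsAcyclic := fun h =>
        hA (isAcyclic_of_subset (Finset.union_subset_union (subset_refl G₁)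
          (Finset.subset_insert _ K₁)) h)
      rw [if_neg hAm, if_neg hA, zero_mul, sub_zero, zero_mul, add_zero]
      apply Finset.sum_eq_zero
      intro G₂ hG₂
      simp only [Finset.mem_filter, Finset.mem_powerset] at hG₂
      exact absurd ((hpred G₂ hG₂.1).1 hG₂.2).1 hA
  have key : ∀ G₁ ∈ D₁.powerset,
      (∏ x ∈ G₁, w x) * ∑ G₂ ∈ D₂.powerset.filter (fun G₂ =>
        (fromEdgeSet ((G₂ ∪ (G₁ ∪ (K₁ ∪ K₂)) : Finset (Sym2 V)) : Set (Sym2 V))).IsAcyclic),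
        ∏ x ∈ G₂, w x =
      (∏ x ∈ G₁, w x) *
        (if (fromEdgeSet ((G₁ ∪ insert s(s, t) K₁ : Finset (Sym2 V)) : Set (Sym2 V))).IsAcyclic
          then (1 : ℝ) else 0) *
        (∑ G ∈ D₂.powerset.filter (fun G =>
          (fromEdgeSet ((G ∪ K₂ : Finset (Sym2 V)) : Set (Sym2 V))).IsAcyclic), ∏ x ∈ G, w x) +
      (∏ x ∈ G₁, w x) *
        (if (fromEdgeSet ((G₁ ∪ K₁ : Finset (Sym2 V)) : Set (Sym2 V))).IsAcyclic
          then (1 : ℝ) else 0) *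
        (∑ G ∈ D₂.powerset.filter (fun G =>
          (fromEdgeSet ((G ∪ insert s(s, t) K₂ : Finset (Sym2 V)) : Set (Sym2 V))).IsAcyclic),
          ∏ x ∈ G, w x) -
      (∏ x ∈ G₁, w x) *
        (if (fromEdgeSet ((G₁ ∪ insert s(s, t) K₁ : Finset (Sym2 V)) : Set (Sym2 V))).IsAcyclic
          then (1 : ℝ) else 0) *
        (∑ G ∈ D₂.powerset.filter (fun G =>
          (fromEdgeSet ((G ∪ insert s(s, t) K₂ : Finset (Sym2 V)) : Set (Sym2 V))).IsAcyclic),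
          ∏ x ∈ G, w x) := by
    intro G₁ hG₁
    rw [inner G₁ hG₁]
    ring
  rw [Finset.sum_congr rfl key, Finset.sum_sub_distrib, Finset.sum_add_distrib, ← Finset.sum_mul,
    ← Finset.sum_mul, ← Finset.sum_mul, sum_powerset_ite_eq, sum_powerset_ite_eq, one_mul, one_mul]

end Forests

end Summit.CriticalPhenomena.PercolationContinuityZ3.Theorems.ForestRayleigh
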